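import Literature.AlgebraicGeometry.Motives.MixedHodgeExtensionSocle
import HarnessLib

/-!
# The Loewy length of a mixed Hodge structure: socle length = radical length

For an object of finite length of an abelian category — here a mixed Hodge structure on a finite-dimensional
`ℚ`-space (Cattani–El Zein–Griffiths–Lê, *Hodge Theory*, Thm. 3.2.18; semisimple objects p. 270) — the ascending
socle series `soc^k H` and the descending radical series `rad^k H` (`MixedHodgeStructureLoewySeries`) terminate
after the same number of steps, the **Loewy length**. This file proves it inside the MHS library:

* §1 the two comparison lemmas: for a sub-MHS `R ⊆ soc^{m+1} H` one has `rad R ⊆ soc^m H`; if `rad R ⊆ soc^j H`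
  then `R ⊆ soc^{j+1} H`; hence **`soc^n H = H ↔ rad^n H = 0`** (`socleSeries_eq_top_iff_radicalSeries_eq_bot`),
  with `rad^j ⊆ soc^{n-j}` along the way.
* §2 termination: `soc^k H` has dimension `≥ k` until it reaches `H`; `soc^{dim H} H = H`.
* §3 **`loewyLength H`** (`Nat.find`), `loewyLength_le_iff` (socle form) and `loewyLength_le_iff_radicalSeries_eq_bot`,
  `≤ dim H`, `= 0 ↔ H = 0`, `≤ 1 ↔ H` semisimple, **self-duality `loewyLength H^∨ = loewyLength H`** (Fujiki (1.6.2):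
  `(soc^k H)^⊥ = rad^k H^∨`), `≤ #weights` for graded-polarizable `H` (Jannsen, Thm. 7.9 (proof)), `≤ 2` for
  extensions with semisimple ends.
* §4 functoriality `f(soc^k H) ⊆ soc^k H'`, `f(rad^k H) ⊆ rad^k H'`; `ℓ` decreases under injections into / surjections
  from, is an isomorphism invariant, and `ℓ(S), ℓ(H/S) ≤ ℓ(H)`.

Namespace `MixedHodgeStructure`; everything proved, no named facts.

## References

* [CattaniElZeinGriffithsLe2014] E. Cattani et al. (eds.), Hodge Theory (2014), Thm. 3.2.18, Lemma 3.2.20, p. 270.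
* [Fujiki1980] A. Fujiki, Duality of mixed Hodge structures of algebraic varieties (1980), (1.6.2).
* [Jannsen1990MixedMotives] U. Jannsen, Mixed Motives and Algebraic K-Theory, LNM 1400 (1990), Thm. 7.9.
-/

noncomputable section

namespace Literature.AlgebraicGeometry.Motives

namespace MixedHodgeStructure

universe u v w

variable {V : Type u} [AddCommGroup V] [Module ℚ V] [FiniteDimensional ℚ V]
variable {H : MixedHodgeStructure V}

open Module

/-! ### §1 `soc^n H = H ↔ rad^n H = 0` -/

/-- **If `R ⊆ soc^{m+1} H` then `rad R ⊆ soc^m H`**: `R → H/soc^m H` lands in the semisimple `soc(H/soc^m H)`, so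
it kills `rad R`. [cite: CattaniElZeinGriffithsLe2014, Thm. 3.2.18 and p. 270] -/
theorem map_subtype_radical_le_socleSeries (R : SubMixedHodgeStructure H) (m : ℕ)
    (hR : R.toSubmodule ≤ (socleSeries H (m + 1)).toSubmodule) :
    (radical R.toMixedHodgeStructure).toSubmodule.map R.toSubmodule.subtype ≤ (socleSeries H m).toSubmodule := by
  let φ : Hom R.toMixedHodgeStructure (socleSeries H m).quotient := (socleSeries H m).mkQ.comp R.subtype
  have hφ : LinearMap.range φ.toLinearMap ≤ (socle (socleSeries H m).quotient).toSubmodule := by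
    rw [← map_socleSeries_succ H m]
    rintro _ ⟨x, rfl⟩
    exact ⟨(x : V), hR x.2, rfl⟩
  have hss : φ.range.toMixedHodgeStructure.IsSemisimple :=
    isSemisimple_of_le_socle φ.range (by rw [Hom.range_toSubmodule]; exact hφ)
  have hker := hss.radical_le_ker φ.rangeRestrict
  rintro _ ⟨r, hr, rfl⟩
  have h0 : φ.rangeRestrict.toLinearMap r = 0 := hker hr
  have h1 : φ.toLinearMap r = 0 := by
    have h2 := congrArg (fun z : ↥φ.range.toSubmodule => (z : V ⧸ (socleSeries H m).toSubmodule)) h0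
    rwa [Hom.coe_rangeRestrict_apply, Submodule.coe_zero] at h2
  exact (Submodule.Quotient.mk_eq_zero _).1 h1

/-- **If `rad R ⊆ soc^j H` then `R ⊆ soc^{j+1} H`**: the image of `R` in `H/soc^j H` is a quotient of the semisimple
`R / rad R`, hence inside `soc(H/soc^j H)`. [cite: CattaniElZeinGriffithsLe2014, Thm. 3.2.18 and p. 270] -/
theorem le_socleSeries_succ_of_map_subtype_radical_le (R : SubMixedHodgeStructure H) (j : ℕ)
    (h : (radical R.toMixedHodgeStructure).toSubmodule.map R.toSubmodule.subtype ≤ (socleSeries H j).toSubmodule) :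
    R.toSubmodule ≤ (socleSeries H (j + 1)).toSubmodule := by
  let ψ : Hom R.toMixedHodgeStructure (socleSeries H j).quotient := (socleSeries H j).mkQ.comp R.subtype
  have hrad : (radical R.toMixedHodgeStructure).toSubmodule ≤ ψ.ker.toSubmodule := fun r hr => by
    rw [Hom.ker_toSubmodule, LinearMap.mem_ker]
    exact (Submodule.Quotient.mk_eq_zero _).2 (h ⟨r, hr, rfl⟩)
  have hss : ψ.range.toMixedHodgeStructure.IsSemisimple :=
    (SubMixedHodgeStructure.isSemisimple_quotient_of_le hrad (isSemisimple_quotient_radical _)).of_bijective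
      ψ.coimageToRange ψ.coimageToRange_bijective
  have hle : LinearMap.range ψ.toLinearMap ≤ (socle (socleSeries H j).quotient).toSubmodule := by
    rw [← Hom.range_toSubmodule]
    exact le_socle ψ.range hss
  intro x hx
  rw [socleSeries_succ_toSubmodule, Submodule.mem_comap]
  exact hle ⟨⟨x, hx⟩, rfl⟩

/-- `soc^n H = H ⇒ rad^j H ⊆ soc^{n-j} H` for `j ≤ n`. [cite: CattaniElZeinGriffithsLe2014, p. 270] -/
theorem radicalSeries_le_socleSeries_of_socleSeries_eq_top {n : ℕ} (hn : (socleSeries H n).toSubmodule = ⊤) :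
    ∀ j ≤ n, (radicalSeries H j).toSubmodule ≤ (socleSeries H (n - j)).toSubmodule := by
  intro j
  induction j with
  | zero => intro; rw [Nat.sub_zero, hn]; exact le_top
  | succ j ih =>
    intro hj
    have h := map_subtype_radical_le_socleSeries (radicalSeries H j) (n - (j + 1))
      (by rw [show n - (j + 1) + 1 = n - j by omega]; exact ih (by omega))
    rw [radicalSeries_succ_toSubmodule]
    exact h

/-- **`soc^n H = H ⇒ rad^n H = 0`.** [cite: CattaniElZeinGriffithsLe2014, p. 270] -/
theorem radicalSeries_eq_bot_of_socleSeries_eq_top {n : ℕ} (hn : (socleSeries H n).toSubmodule = ⊤) :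
    (radicalSeries H n).toSubmodule = ⊥ := by
  have h := radicalSeries_le_socleSeries_of_socleSeries_eq_top hn n le_rfl
  rw [Nat.sub_self, socleSeries_zero, SubMixedHodgeStructure.bot_toSubmodule] at h
  exact le_bot_iff.1 h

/-- `rad^n H = 0 ⇒ rad^{n-j} H ⊆ soc^j H` for `j ≤ n`. [cite: CattaniElZeinGriffithsLe2014, p. 270] -/
theorem radicalSeries_le_socleSeries_of_radicalSeries_eq_bot {n : ℕ} (hn : (radicalSeries H n).toSubmodule = ⊥) :
    ∀ j ≤ n, (radicalSeries H (n - j)).toSubmodule ≤ (socleSeries H j).toSubmodule := by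
  intro j
  induction j with
  | zero => intro; rw [Nat.sub_zero, hn]; exact bot_le
  | succ j ih =>
    intro hj
    apply le_socleSeries_succ_of_map_subtype_radical_le
    have ih' := ih (by omega)
    rw [show n - j = n - (j + 1) + 1 by omega, radicalSeries_succ_toSubmodule] at ih'
    exact ih'

/-- **`rad^n H = 0 ⇒ soc^n H = H`.** [cite: CattaniElZeinGriffithsLe2014, p. 270] -/
theorem socleSeries_eq_top_of_radicalSeries_eq_bot {n : ℕ} (hn : (radicalSeries H n).toSubmodule = ⊥) :
    (socleSeries H n).toSubmodule = ⊤ := by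
  have h := radicalSeries_le_socleSeries_of_radicalSeries_eq_bot hn n le_rfl
  rw [Nat.sub_self, radicalSeries_zero, SubMixedHodgeStructure.top_toSubmodule] at h
  exact eq_top_iff.2 h

/-- **Socle length = radical length: `soc^n H = H ↔ rad^n H = 0`.** [cite: CattaniElZeinGriffithsLe2014, p. 270] -/
theorem socleSeries_eq_top_iff_radicalSeries_eq_bot (n : ℕ) :
    (socleSeries H n).toSubmodule = ⊤ ↔ (radicalSeries H n).toSubmodule = ⊥ :=
  ⟨radicalSeries_eq_bot_of_socleSeries_eq_top, socleSeries_eq_top_of_radicalSeries_eq_bot⟩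

/-- By duality: `soc^n H = H ↔ soc^n H^∨ = H^∨`. [cite: Fujiki1980, (1.6.2)] -/
theorem socleSeries_eq_top_iff_socleSeries_dual_eq_top (n : ℕ) :
    (socleSeries H n).toSubmodule = ⊤ ↔ (socleSeries H.dual n).toSubmodule = ⊤ := by
  rw [socleSeries_eq_top_iff_radicalSeries_dual_eq_bot, socleSeries_eq_top_iff_radicalSeries_eq_bot]

/-! ### §2 Termination -/

/-- Until it reaches `H`, the socle series gains dimension at every step (`soc(H/soc^k) ≠ 0`).
[cite: CattaniElZeinGriffithsLe2014, Thm. 3.2.18 and p. 270] -/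
theorem socleSeries_eq_top_or_le_finrank (k : ℕ) :
    (socleSeries H k).toSubmodule = ⊤ ∨ k ≤ finrank ℚ (socleSeries H k).toSubmodule := by
  induction k with
  | zero => exact Or.inr (Nat.zero_le _)
  | succ k ih =>
    by_cases htop : (socleSeries H k).toSubmodule = ⊤
    · exact Or.inl (socleSeries_eq_top_of_le H (Nat.le_succ k) htop)
    · refine Or.inr ?_
      rcases ih with h | h
      · exact absurd h htop
      · have hlt : (socleSeries H k).toSubmodule < (socleSeries H (k + 1)).toSubmodule := by
          refine lt_of_le_of_ne (le_socleSeries_succ H k) fun heq => ?_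
          haveI : Nontrivial (V ⧸ (socleSeries H k).toSubmodule) := Submodule.Quotient.nontrivial_iff.2 htop
          apply socle_ne_bot (H := (socleSeries H k).quotient)
          rw [← map_socleSeries_succ H k, ← heq]
          exact Submodule.mkQ_map_self _
        have hlt' := Submodule.finrank_lt_finrank_of_lt hlt
        omega

/-- **`soc^{dim H} H = H`.** [cite: CattaniElZeinGriffithsLe2014, Thm. 3.2.18 and p. 270] -/
theorem socleSeries_finrank_eq_top : (socleSeries H (finrank ℚ V)).toSubmodule = ⊤ := by
  rcases socleSeries_eq_top_or_le_finrank (H := H) (finrank ℚ V) with h | h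
  · exact h
  · exact Submodule.eq_top_of_finrank_eq (le_antisymm (Submodule.finrank_le _) h)

/-- `rad^{dim H} H = 0`. [cite: CattaniElZeinGriffithsLe2014, Thm. 3.2.18 and p. 270] -/
theorem radicalSeries_finrank_eq_bot : (radicalSeries H (finrank ℚ V)).toSubmodule = ⊥ :=
  radicalSeries_eq_bot_of_socleSeries_eq_top socleSeries_finrank_eq_top

/-- The socle series reaches `H`. [cite: CattaniElZeinGriffithsLe2014, p. 270] -/
theorem exists_socleSeries_eq_top : ∃ n : ℕ, (socleSeries H n).toSubmodule = ⊤ :=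
  ⟨_, socleSeries_finrank_eq_top⟩

/-! ### §3 The Loewy length -/

section LoewyLength

variable (H)

open scoped Classical in
/-- **The Loewy length of `H`**: the least `n` with `soc^n H = H` (equivalently `rad^n H = 0`).
[cite: CattaniElZeinGriffithsLe2014, Thm. 3.2.18 and p. 270] -/
def loewyLength : ℕ :=
  Nat.find (exists_socleSeries_eq_top (H := H))

open scoped Classical in
/-- `soc^ℓ H = H` for `ℓ` the Loewy length. [cite: CattaniElZeinGriffithsLe2014, p. 270] -/
theorem socleSeries_loewyLength_eq_top : (socleSeries H (loewyLength H)).toSubmodule = ⊤ :=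
  Nat.find_spec (exists_socleSeries_eq_top (H := H))

open scoped Classical in
/-- `ℓ(H) ≤ n ↔ soc^n H = H`. [cite: CattaniElZeinGriffithsLe2014, p. 270] -/
theorem loewyLength_le_iff {n : ℕ} : loewyLength H ≤ n ↔ (socleSeries H n).toSubmodule = ⊤ := by
  rw [loewyLength, Nat.find_le_iff]
  exact ⟨fun ⟨m, hm, h⟩ => socleSeries_eq_top_of_le H hm h, fun h => ⟨n, le_rfl, h⟩⟩

variable {H}

/-- **`ℓ(H) ≤ n ↔ rad^n H = 0`.** [cite: CattaniElZeinGriffithsLe2014, p. 270] -/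
theorem loewyLength_le_iff_radicalSeries_eq_bot {n : ℕ} :
    loewyLength H ≤ n ↔ (radicalSeries H n).toSubmodule = ⊥ := by
  rw [loewyLength_le_iff, socleSeries_eq_top_iff_radicalSeries_eq_bot]

/-- `rad^ℓ H = 0`. [cite: CattaniElZeinGriffithsLe2014, p. 270] -/
theorem radicalSeries_loewyLength_eq_bot : (radicalSeries H (loewyLength H)).toSubmodule = ⊥ :=
  loewyLength_le_iff_radicalSeries_eq_bot.1 le_rfl

/-- Minimality: `soc^n H ≠ H` for `n < ℓ(H)`. [cite: CattaniElZeinGriffithsLe2014, p. 270] -/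
theorem socleSeries_ne_top_of_lt {n : ℕ} (hn : n < loewyLength H) : (socleSeries H n).toSubmodule ≠ ⊤ :=
  fun h => absurd ((loewyLength_le_iff H).2 h) (not_le.2 hn)

/-- Minimality: `rad^n H ≠ 0` for `n < ℓ(H)`. [cite: CattaniElZeinGriffithsLe2014, p. 270] -/
theorem radicalSeries_ne_bot_of_lt {n : ℕ} (hn : n < loewyLength H) : (radicalSeries H n).toSubmodule ≠ ⊥ :=
  fun h => absurd (loewyLength_le_iff_radicalSeries_eq_bot.2 h) (not_le.2 hn)

/-- `ℓ(H) ≤ dim H`. [cite: CattaniElZeinGriffithsLe2014, p. 270] -/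
theorem loewyLength_le_finrank : loewyLength H ≤ finrank ℚ V :=
  (loewyLength_le_iff H).2 socleSeries_finrank_eq_top

/-- `ℓ(H) = 0 ↔ H = 0`. [cite: CattaniElZeinGriffithsLe2014, p. 270] -/
theorem loewyLength_eq_zero_iff : loewyLength H = 0 ↔ Subsingleton V := by
  rw [← Nat.le_zero, loewyLength_le_iff, socleSeries_zero, SubMixedHodgeStructure.bot_toSubmodule]
  constructor
  · intro h
    exact (Submodule.subsingleton_iff ℚ).1 (subsingleton_of_bot_eq_top h)
  · intro h
    haveI := (Submodule.subsingleton_iff ℚ).2 h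
    exact Subsingleton.elim _ _

/-- `0 < ℓ(H) ↔ H ≠ 0`. [cite: CattaniElZeinGriffithsLe2014, p. 270] -/
theorem loewyLength_pos_iff : 0 < loewyLength H ↔ Nontrivial V := by
  rw [pos_iff_ne_zero, Ne, loewyLength_eq_zero_iff, not_subsingleton_iff_nontrivial]

/-- **`ℓ(H) ≤ 1 ↔ H` is semisimple.** [cite: CattaniElZeinGriffithsLe2014, p. 270] -/
theorem loewyLength_le_one_iff : loewyLength H ≤ 1 ↔ H.IsSemisimple := by
  rw [loewyLength_le_iff, socleSeries_one, socle_eq_top_iff]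

/-- A semisimple MHS has Loewy length `≤ 1`. [cite: CattaniElZeinGriffithsLe2014, p. 270] -/
theorem IsSemisimple.loewyLength_le_one (h : H.IsSemisimple) : loewyLength H ≤ 1 :=
  loewyLength_le_one_iff.2 h

/-- A non-zero semisimple MHS has Loewy length `1`. [cite: CattaniElZeinGriffithsLe2014, p. 270] -/
theorem IsSemisimple.loewyLength_eq_one [Nontrivial V] (h : H.IsSemisimple) : loewyLength H = 1 :=
  le_antisymm h.loewyLength_le_one (loewyLength_pos_iff.2 inferInstance)

/-- **Self-duality: `ℓ(H^∨) = ℓ(H)`** (`(soc^k H)^⊥ = rad^k H^∨` and socle length = radical length).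
[cite: Fujiki1980, (1.6.2)] [cite: CattaniElZeinGriffithsLe2014, p. 270] -/
theorem loewyLength_dual : loewyLength H.dual = loewyLength H := by
  apply le_antisymm
  · rw [loewyLength_le_iff, ← socleSeries_eq_top_iff_socleSeries_dual_eq_top]
    exact socleSeries_loewyLength_eq_top H
  · rw [loewyLength_le_iff, socleSeries_eq_top_iff_socleSeries_dual_eq_top]
    exact socleSeries_loewyLength_eq_top H.dual

/-- **Graded-polarizable: `ℓ(H) ≤` the number of weights** (`W_{a-1} H = 0`, `W_b H = H` ⇒ `ℓ(H) ≤ b - a + 1`).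
[cite: Jannsen1990MixedMotives, Thm. 7.9 (proof)] [cite: CattaniElZeinGriffithsLe2014, p. 270] -/
theorem IsGradedPolarizable.loewyLength_le (hp : H.IsGradedPolarizable) {a b : ℤ} (ha : H.W (a - 1) = ⊥)
    (hb : H.W b = ⊤) : loewyLength H ≤ (b - a + 1).toNat :=
  (loewyLength_le_iff H).2 (hp.socleSeries_eq_top ha hb _ (Int.self_le_toNat _))

/-- Two weights: `ℓ(H) ≤ 2`. [cite: Jannsen1990MixedMotives, Thm. 7.9 (proof)] -/
theorem IsGradedPolarizable.loewyLength_le_two (hp : H.IsGradedPolarizable) {n : ℤ} (h₁ : H.W (n - 2) = ⊥)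
    (h₂ : H.W n = ⊤) : loewyLength H ≤ 2 :=
  (loewyLength_le_iff H).2 (hp.socleSeries_two_eq_top_of_two_weights h₁ h₂)

end LoewyLength

/-! ### §4 Functoriality: morphisms map `soc^k` to `soc^k`, `rad^k` to `rad^k`; monotonicity of `ℓ` -/

section Functorial

variable {V' : Type v} [AddCommGroup V'] [Module ℚ V'] [FiniteDimensional ℚ V'] {H' : MixedHodgeStructure V'}

/-- **`f(soc^k H) ⊆ soc^k H'`** for every morphism `f` (inductively, `f` induces `H/soc^k H → H'/soc^k H'`, which maps
socle to socle). [cite: CattaniElZeinGriffithsLe2014, Thm. 3.2.18 and p. 270] -/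
theorem Hom.map_socleSeries_le (f : Hom H H') (k : ℕ) :
    (socleSeries H k).toSubmodule.map f.toLinearMap ≤ (socleSeries H' k).toSubmodule := by
  induction k with
  | zero =>
    rw [socleSeries_zero, socleSeries_zero, SubMixedHodgeStructure.bot_toSubmodule,
      SubMixedHodgeStructure.bot_toSubmodule, Submodule.map_bot]
  | succ k ih =>
    have hf : ∀ x ∈ (socleSeries H k).toSubmodule, f.toLinearMap x ∈ (socleSeries H' k).toSubmodule :=
      fun x hx => ih ⟨x, hx, rfl⟩
    intro y hy
    obtain ⟨x, hx, rfl⟩ := Submodule.mem_map.1 hy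
    rw [socleSeries_succ_toSubmodule, Submodule.mem_comap] at hx ⊢
    exact ((socleSeries H k).quotientMap (socleSeries H' k) f hf).apply_mem_socle hx

/-- Elementwise form. [cite: CattaniElZeinGriffithsLe2014, p. 270] -/
theorem Hom.apply_mem_socleSeries (f : Hom H H') {k : ℕ} {x : V} (hx : x ∈ (socleSeries H k).toSubmodule) :
    f.toLinearMap x ∈ (socleSeries H' k).toSubmodule :=
  f.map_socleSeries_le k ⟨x, hx, rfl⟩

/-- **`f(rad^k H) ⊆ rad^k H'`** for every morphism `f` (inductively, `f` restricts to `rad^k H → rad^k H'`, which maps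
radical to radical). [cite: CattaniElZeinGriffithsLe2014, Thm. 3.2.18 and p. 270] -/
theorem Hom.map_radicalSeries_le (f : Hom H H') (k : ℕ) :
    (radicalSeries H k).toSubmodule.map f.toLinearMap ≤ (radicalSeries H' k).toSubmodule := by
  induction k with
  | zero => rw [radicalSeries_zero, SubMixedHodgeStructure.top_toSubmodule]; exact le_top
  | succ k ih =>
    have hf : ∀ x ∈ (radicalSeries H k).toSubmodule, f.toLinearMap x ∈ (radicalSeries H' k).toSubmodule :=
      fun x hx => ih ⟨x, hx, rfl⟩
    rw [radicalSeries_succ_toSubmodule, radicalSeries_succ_toSubmodule]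
    intro y hy
    obtain ⟨z, hz, rfl⟩ := Submodule.mem_map.1 hy
    obtain ⟨r, hr, rfl⟩ := Submodule.mem_map.1 hz
    exact ⟨((radicalSeries H k).restrictHom (radicalSeries H' k) f hf).toLinearMap r, Hom.apply_mem_radical _ hr, rfl⟩

/-- Elementwise form. [cite: CattaniElZeinGriffithsLe2014, p. 270] -/
theorem Hom.apply_mem_radicalSeries (f : Hom H H') {k : ℕ} {x : V} (hx : x ∈ (radicalSeries H k).toSubmodule) :
    f.toLinearMap x ∈ (radicalSeries H' k).toSubmodule :=
  f.map_radicalSeries_le k ⟨x, hx, rfl⟩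

/-- **`ℓ(H) ≤ ℓ(H')` if `H ↪ H'`** (`rad^k H ↪ rad^k H'`). [cite: CattaniElZeinGriffithsLe2014, p. 270] -/
theorem Hom.loewyLength_le_of_injective (f : Hom H H') (hf : Function.Injective f.toLinearMap) :
    loewyLength H ≤ loewyLength H' := by
  rw [loewyLength_le_iff_radicalSeries_eq_bot, eq_bot_iff]
  intro x hx
  have h := f.apply_mem_radicalSeries (k := loewyLength H') hx
  rw [radicalSeries_loewyLength_eq_bot, Submodule.mem_bot, ← map_zero f.toLinearMap] at h
  exact (Submodule.mem_bot ℚ).2 (hf h)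

/-- **`ℓ(H') ≤ ℓ(H)` if `H ↠ H'`** (`soc^k H ↠` into `soc^k H'`). [cite: CattaniElZeinGriffithsLe2014, p. 270] -/
theorem Hom.loewyLength_le_of_surjective (f : Hom H H') (hf : Function.Surjective f.toLinearMap) :
    loewyLength H' ≤ loewyLength H := by
  rw [loewyLength_le_iff, eq_top_iff]
  intro y _
  obtain ⟨x, rfl⟩ := hf y
  exact f.apply_mem_socleSeries (by rw [socleSeries_loewyLength_eq_top]; exact Submodule.mem_top)

/-- **Isomorphic MHS have the same Loewy length.** [cite: CattaniElZeinGriffithsLe2014, p. 270] -/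
theorem Hom.loewyLength_eq_of_bijective (f : Hom H H') (hf : Function.Bijective f.toLinearMap) :
    loewyLength H = loewyLength H' :=
  le_antisymm (f.loewyLength_le_of_injective hf.1) (f.loewyLength_le_of_surjective hf.2)

/-- `ℓ(Im f) ≤ min (ℓ H) (ℓ H')`. [cite: CattaniElZeinGriffithsLe2014, p. 270] -/
theorem Hom.loewyLength_range_le (f : Hom H H') :
    loewyLength f.range.toMixedHodgeStructure ≤ min (loewyLength H) (loewyLength H') :=
  le_min (f.rangeRestrict.loewyLength_le_of_surjective f.rangeRestrict_surjective)
    (f.range.subtype.loewyLength_le_of_injective (Submodule.injective_subtype _))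

end Functorial

/-- **`ℓ(S) ≤ ℓ(H)` for a sub-MHS `S`.** [cite: CattaniElZeinGriffithsLe2014, p. 270] -/
theorem SubMixedHodgeStructure.loewyLength_le (S : SubMixedHodgeStructure H) :
    loewyLength S.toMixedHodgeStructure ≤ loewyLength H :=
  S.subtype.loewyLength_le_of_injective (Submodule.injective_subtype _)

/-- **`ℓ(H/S) ≤ ℓ(H)` for a sub-MHS `S`.** [cite: CattaniElZeinGriffithsLe2014, p. 270] -/
theorem SubMixedHodgeStructure.loewyLength_quotient_le (S : SubMixedHodgeStructure H) :
    loewyLength S.quotient ≤ loewyLength H :=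
  S.mkQ.loewyLength_le_of_surjective (Submodule.mkQ_surjective _)

/-- **`ℓ(H₁ ⊕ H₂) ≥ max (ℓ H₁) (ℓ H₂)`** (both summands are quotients). [cite: CattaniElZeinGriffithsLe2014, p. 270] -/
theorem max_loewyLength_le_loewyLength_prod {V' : Type v} [AddCommGroup V'] [Module ℚ V'] [FiniteDimensional ℚ V']
    (H₁ : MixedHodgeStructure V) (H₂ : MixedHodgeStructure V') :
    max (loewyLength H₁) (loewyLength H₂) ≤ loewyLength (H₁.prod H₂) :=
  max_le ((Hom.fst H₁ H₂).loewyLength_le_of_surjective fun a => ⟨(a, 0), rfl⟩)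
    ((Hom.snd H₁ H₂).loewyLength_le_of_surjective fun b => ⟨(0, b), rfl⟩)

/-- **An extension with semisimple ends has Loewy length `≤ 2`.** [cite: CattaniElZeinGriffithsLe2014, p. 270] -/
theorem Extension.loewyLength_le_two {VA : Type v} [AddCommGroup VA] [Module ℚ VA]
    {VB : Type w} [AddCommGroup VB] [Module ℚ VB] [FiniteDimensional ℚ VB]
    {A : MixedHodgeStructure VA} {B : MixedHodgeStructure VB} (E : Extension A B V)
    (hA : A.IsSemisimple) (hB : B.IsSemisimple) : loewyLength E.mhs ≤ 2 :=
  (loewyLength_le_iff E.mhs).2 (E.socleSeries_two_eq_top hA hB)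

end MixedHodgeStructure

end Literature.AlgebraicGeometry.Motives
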